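import Summits.Ventures.Crystal3D.Theorems.StickyWulffConstantPolycrystalWulffBoundInterfaceFacetSums
import Summits.Ventures.Crystal3D.Theorems.StickyWulffConstantPolycrystalWulffBoundPolyRefinementFullOfVolume
import Summits.Ventures.Crystal3D.Theorems.StickyWulffConstantPolycrystalWulffBoundPolyFacetSums
import Summits.Ventures.Crystal3D.Theorems.StickyWulffConstantTextureLiminfPolytopeCalculus
import Literature.Analysis.Convexity.AnisotropicPerimeterHole
import Literature.Analysis.Convexity.AnisotropicPerimeterPolytopePrism
import Literature.Analysis.Convexity.AnisotropicPerimeterBox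
import Literature.Analysis.Convexity.SupportFunction
import Literature.Analysis.Convexity.OpenHPolytope

/-!
# `PolycrystalWulffBound`: EXTERIOR CALCULUS — the two-sided energy of a cell family is a cross sum

Route `StickyWulffConstant` of the venture `Summits/Ventures/Crystal3D`, crux `PolycrystalWulffBound`
(item `stmt-Ventures-19482`), second prover lane (poly-p2).  Set-level bookkeeping for polyhedral
textures that avoids any facet-by-facet matching: for a family of cells `Q_j = polytope (H j)`,
`j : Fin k`, with the hypotheses of clause (B) of `PolytopeCalculus` (landed:
`stub_polytopeCalculus`) and a CONTAINER `A =ᵐ ⋃_j Q_j` of finite `K`-perimeter, every index set `s`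
whose cells stay away from the container's boundary (`closure (⋃_{j∈s} Q_j) ⊆ interior A`) has

  `per K (⋃_{s} Q) + per (−K) (⋃_{s} Q) = crossSum_K(s, univ \ s)`          (CORE)

where `crossSum_K(s, t) = Σ_{a∈s} Σ_{b∈t} (h_K(ν)+h_K(−ν))·facetArea(Q̄_a ∩ Q̄_b)` (clause (B)'s
term, min-oriented) — i.e. the WHOLE boundary of `⋃_s Q` is interface with the complementary cells.
Ingredients: the cross-sum identity `per_add_per_sub_per_union_eq_crossSum_of_polytopeCalculus`
(gen-0, p544110) with `sA = s`, `sB = univ \ s`, and the HOLE RULE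
`P_K(A \ G) = P_K(A) + P_{−K}(G)` (`Literature.Analysis.Convexity.anisotropicPerimeter_diff_eq_add_neg`).
Also: cross terms are MONOTONE in the body (`crossSum_mono`: support functions are) and nonnegative,
and cell unions have finite `K`-perimeter (`perK_biUnion_polytope_ne_top`, from clause (A)).
The texture-level consequences (free energy `= ½ Σ_f crossSum_{W_f}(S_f, S_X) ≥ √3·Per(E)`, wall
identity `Σ_{f≠g} ι_B = Σ_f Per(G_f) − Per(E)`) are `…ExteriorCrossSums.lean`.
WHAT THIS IS NOT: anything on grains in contact beyond bookkeeping; the crux is not claimed.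
-/

noncomputable section

namespace Summit.Ventures.Crystal3D.Theorems

open MeasureTheory Set
open scoped RealInnerProductSpace ENNReal Pointwise
open Summit.Ventures.Crystal3D.Cruxes.TextureLiminf.TexShadow
open Literature.Analysis.Convexity

/-! ### Cross terms: monotone in the body, nonnegative -/

/-- The cross term `(h_K(ν) + h_K(−ν)) · facetArea F ν` of clause (B) is MONOTONE in the constraint
body: `K ⊆ K'` (`K` nonempty, `K'` bounded). -/
theorem crossTerm_mono {K K' : Set E3} (hKK' : K ⊆ K') (hK' : Bornology.IsBounded K')
    (hK : K.Nonempty) (F : Set E3) (ν : E3) :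
    (supportFn K ν + supportFn K (-ν)) * facetArea F ν ≤
      (supportFn K' ν + supportFn K' (-ν)) * facetArea F ν := by
  unfold supportFn facetArea
  exact mul_le_mul_of_nonneg_right
    (add_le_add (sSup_inner_image_mono hKK' hK' hK ν) (sSup_inner_image_mono hKK' hK' hK (-ν)))
    ENNReal.toReal_nonneg

/-- The cross term is nonnegative for a compact body containing the origin. -/
theorem crossTerm_nonneg {K : Set E3} (hK : IsCompact K) (h0 : (0 : E3) ∈ K) (F : Set E3)
    (ν : E3) : 0 ≤ (supportFn K ν + supportFn K (-ν)) * facetArea F ν := by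
  unfold supportFn facetArea
  exact mul_nonneg (add_nonneg (sSup_inner_image_nonneg hK h0 ν) (sSup_inner_image_nonneg hK h0 (-ν)))
    ENNReal.toReal_nonneg

/-- **Cross sums are monotone in the body**: for `K ⊆ K'` (`K` nonempty, `K'` bounded) and any
index sets `s, t`, `crossSum_K(s, t) ≤ crossSum_{K'}(s, t)`. -/
theorem crossSum_mono {K K' : Set E3} (hKK' : K ⊆ K') (hK' : Bornology.IsBounded K')
    (hK : K.Nonempty) {k : ℕ} (H : Fin k → Finset (E3 × ℝ)) (ν : Fin k → Fin k → E3)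
    (s t : Finset (Fin k)) :
    (∑ a ∈ s, ∑ b ∈ t,
        (if a < b then (supportFn K (ν a b) + supportFn K (-ν a b)) *
            facetArea (closure (polytope (H a)) ∩ closure (polytope (H b))) (ν a b)
          else (supportFn K (ν b a) + supportFn K (-ν b a)) *
            facetArea (closure (polytope (H b)) ∩ closure (polytope (H a))) (ν b a))) ≤
      ∑ a ∈ s, ∑ b ∈ t,
        (if a < b then (supportFn K' (ν a b) + supportFn K' (-ν a b)) *
            facetArea (closure (polytope (H a)) ∩ closure (polytope (H b))) (ν a b)
          else (supportFn K' (ν b a) + supportFn K' (-ν b a)) *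
            facetArea (closure (polytope (H b)) ∩ closure (polytope (H a))) (ν b a)) := by
  refine Finset.sum_le_sum fun a _ => Finset.sum_le_sum fun b _ => ?_
  split_ifs
  · exact crossTerm_mono hKK' hK' hK _ _
  · exact crossTerm_mono hKK' hK' hK _ _

/-- **Cross sums are nonnegative** for a compact body containing the origin. -/
theorem crossSum_nonneg {K : Set E3} (hK : IsCompact K) (h0 : (0 : E3) ∈ K) {k : ℕ}
    (H : Fin k → Finset (E3 × ℝ)) (ν : Fin k → Fin k → E3) (s t : Finset (Fin k)) :
    0 ≤ ∑ a ∈ s, ∑ b ∈ t,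
        (if a < b then (supportFn K (ν a b) + supportFn K (-ν a b)) *
            facetArea (closure (polytope (H a)) ∩ closure (polytope (H b))) (ν a b)
          else (supportFn K (ν b a) + supportFn K (-ν b a)) *
            facetArea (closure (polytope (H b)) ∩ closure (polytope (H a))) (ν b a)) := by
  refine Finset.sum_nonneg fun a _ => Finset.sum_nonneg fun b _ => ?_
  split_ifs
  · exact crossTerm_nonneg hK h0 _ _
  · exact crossTerm_nonneg hK h0 _ _

/-! ### Cells: measurability, finite `K`-perimeter of cell unions, complementary unions -/

/-- An open `H`-polytope is measurable. -/
theorem measurableSet_polytope (G : Finset (E3 × ℝ)) : MeasurableSet (polytope G) :=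
  (isOpen_openHPolytope G).measurableSet

/-- A finite union of cells is measurable. -/
theorem measurableSet_biUnion_polytope {k : ℕ} (H : Fin k → Finset (E3 × ℝ))
    (s : Finset (Fin k)) : MeasurableSet (⋃ j ∈ s, polytope (H j)) :=
  Finset.measurableSet_biUnion s fun j _ => measurableSet_polytope (H j)

/-- **Cell unions have finite `K`-perimeter** (`K` compact convex `∋ 0`; cells bounded with unit
normals and distinct facet planes, pairwise disjoint): clause (A) evaluates each cell's perimeter
as a (finite) facet sum, and the perimeter is subadditive over disjoint measurable pieces. -/
theorem perK_biUnion_polytope_ne_top {K : Set E3} (hK : IsCompact K) (hKc : Convex ℝ K)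
    (h0 : (0 : E3) ∈ K) {k : ℕ} (H : Fin k → Finset (E3 × ℝ))
    (hbd : ∀ j, Bornology.IsBounded (polytope (H j)))
    (hunit : ∀ j, ∀ q ∈ H j, ‖q.1‖ = 1)
    (hdist : ∀ j, ∀ q ∈ H j, ∀ q' ∈ H j, q ≠ q' →
      {x : E3 | ⟪q.1, x⟫ = q.2} ≠ {x : E3 | ⟪q'.1, x⟫ = q'.2})
    (hdisj : ∀ j j', j ≠ j' → Disjoint (polytope (H j)) (polytope (H j')))
    (s : Finset (Fin k)) : perK K (⋃ j ∈ s, polytope (H j)) ≠ ⊤ := by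
  rw [perK_eq_anisotropicPerimeter]
  refine ne_top_of_le_ne_top ?_ (anisotropicPerimeter_biUnion_le_sum K s
    (fun j _ => measurableSet_polytope (H j)) fun i _ j _ hij => hdisj i j hij)
  refine ENNReal.sum_ne_top.2 fun j _ => ?_
  rw [show polytope (H j) = ⋂ q ∈ H j, {x : E3 | ⟪q.1, x⟫ < q.2} from rfl,
    anisotropicPerimeter_iInter_halfSpace_lt_eq_facetSum (H j) (hbd j) (hunit j) (hdist j) hK hKc h0]
  exact ENNReal.ofReal_ne_top

/-- The union of the cells OUTSIDE `s` is the union of all cells minus the union over `s`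
(cells pairwise disjoint). -/
theorem biUnion_sdiff_eq_iUnion_diff {k : ℕ} (Q : Fin k → Set E3)
    (hdisj : ∀ i j, i ≠ j → Disjoint (Q i) (Q j)) (s : Finset (Fin k)) :
    (⋃ j ∈ (Finset.univ \ s), Q j) = (⋃ j, Q j) \ ⋃ j ∈ s, Q j := by
  ext x
  simp only [mem_iUnion, mem_sdiff, Finset.mem_sdiff, Finset.mem_univ, true_and, exists_prop,
    not_exists, not_and]
  constructor
  · rintro ⟨j, hj, hx⟩
    refine ⟨⟨j, hx⟩, fun i hi hxi => ?_⟩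
    have hij : i ≠ j := fun h => hj (h ▸ hi)
    exact Set.disjoint_left.1 (hdisj i j hij) hxi hx
  · rintro ⟨⟨j, hx⟩, h⟩
    exact ⟨j, fun hj => h j hj hx, hx⟩

/-- The union over `Finset.univ` is the plain indexed union. -/
theorem biUnion_univ_eq_iUnion {k : ℕ} (Q : Fin k → Set E3) :
    (⋃ j ∈ (Finset.univ : Finset (Fin k)), Q j) = ⋃ j, Q j := by
  ext x; simp

/-! ### CORE: the two-sided energy of a cell union is its cross sum with the complementary cells -/

/-- **Exterior calculus, core identity.** Let `K` be compact convex with `0 ∈ K`; let the cells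
`Q_j = polytope (H j)` (`j : Fin k`) be bounded with unit normals and distinct facet planes, pairwise
disjoint, with unit common-plane normals `ν` (clause (B)'s hypotheses); let the CONTAINER `A` be a
measurable set, a.e. equal to `⋃_j Q_j`, of finite `K`-perimeter; and let `s` be an index set whose
cells stay inside: `closure (⋃_{j∈s} Q_j) ⊆ interior A`.  Then
`per K (⋃_{s} Q) + per (−K) (⋃_{s} Q) = crossSum_K(s, univ \ s)`:
the whole boundary of `⋃_s Q` (both orientations) is interface with the complementary cells.
(Clause (B) cross-sum identity with `sB = univ \ s`, where `⋃_{univ \ s} Q =ᵐ A \ ⋃_s Q`, and the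
hole rule `per K (A \ G) = per K A + per (−K) G`.) -/
theorem per_add_per_neg_eq_crossSum_compl {K : Set E3} (hK : IsCompact K) (hKc : Convex ℝ K)
    (h0 : (0 : E3) ∈ K) {k : ℕ} (H : Fin k → Finset (E3 × ℝ)) (ν : Fin k → Fin k → E3)
    (hbd : ∀ j, Bornology.IsBounded (polytope (H j)))
    (hunit : ∀ j, ∀ q ∈ H j, ‖q.1‖ = 1)
    (hdist : ∀ j, ∀ q ∈ H j, ∀ q' ∈ H j, q ≠ q' →
      {x : E3 | ⟪q.1, x⟫ = q.2} ≠ {x : E3 | ⟪q'.1, x⟫ = q'.2})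
    (hdisj : ∀ j j', j ≠ j' → Disjoint (polytope (H j)) (polytope (H j')))
    (hplane : ∀ j j', j ≠ j' → ‖ν j j'‖ = 1 ∧ ∃ b : ℝ,
      closure (polytope (H j)) ∩ closure (polytope (H j')) ⊆ {x | ⟪ν j j', x⟫ = b})
    {A : Set E3} (hAm : MeasurableSet A) (hA : A =ᵐ[volume] ⋃ j, polytope (H j))
    (hAfin : perK K A ≠ ⊤) (s : Finset (Fin k))
    (hcl : closure (⋃ j ∈ s, polytope (H j)) ⊆ interior A) :
    per K (⋃ j ∈ s, polytope (H j)) + per (-K) (⋃ j ∈ s, polytope (H j)) =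
      ∑ a ∈ s, ∑ b ∈ (Finset.univ \ s),
        (if a < b then (supportFn K (ν a b) + supportFn K (-ν a b)) *
            facetArea (closure (polytope (H a)) ∩ closure (polytope (H b))) (ν a b)
          else (supportFn K (ν b a) + supportFn K (-ν b a)) *
            facetArea (closure (polytope (H b)) ∩ closure (polytope (H a))) (ν b a)) := by
  have hx := per_add_per_sub_per_union_eq_crossSum_of_polytopeCalculus stub_polytopeCalculus hK
    hKc h0 H ν hbd hdisj hplane (Finset.disjoint_sdiff (s := s) (t := Finset.univ))
  -- the union over `s ∪ (univ \ s)` is the container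
  have hsu : s ∪ (Finset.univ \ s) = Finset.univ :=
    Finset.union_sdiff_of_subset (Finset.subset_univ s)
  have h1 : per K (⋃ j ∈ s ∪ (Finset.univ \ s), polytope (H j)) = per K A := by
    rw [hsu, biUnion_univ_eq_iUnion]
    exact (per_congr_ae K hA).symm
  -- the union over `univ \ s` is the container minus the union over `s`
  have hdiff : (⋃ j ∈ (Finset.univ \ s), polytope (H j)) =ᵐ[volume]
      A \ ⋃ j ∈ s, polytope (H j) := by
    rw [biUnion_sdiff_eq_iUnion_diff (fun j => polytope (H j)) hdisj s]
    exact hA.symm.diff (ae_eq_refl _)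
  have hKn : IsCompact (-K) := hK.neg
  have hKcn : Convex ℝ (-K) := hKc.neg
  have h0n : (0 : E3) ∈ -K := by simpa using h0
  have hfinU : perK (-K) (⋃ j ∈ s, polytope (H j)) ≠ ⊤ :=
    perK_biUnion_polytope_ne_top hKn hKcn h0n H hbd hunit hdist hdisj s
  have h2 : per K (⋃ j ∈ (Finset.univ \ s), polytope (H j)) =
      per K A + per (-K) (⋃ j ∈ s, polytope (H j)) := by
    rw [per_congr_ae K hdiff]
    show (perK K (A \ ⋃ j ∈ s, polytope (H j))).toReal =
      (perK K A).toReal + (perK (-K) (⋃ j ∈ s, polytope (H j))).toReal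
    rw [perK_eq_anisotropicPerimeter, anisotropicPerimeter_diff_eq_add_neg hKc h0 hAm
      (measurableSet_biUnion_polytope H s) hcl]
    exact ENNReal.toReal_add hAfin hfinU
  rw [h1, h2] at hx
  linarith

/-- **Core identity for an origin-symmetric body** (`−K = K`):
`2 · per K (⋃_{s} Q) = crossSum_K(s, univ \ s)`. -/
theorem two_mul_per_eq_crossSum_compl {K : Set E3} (hK : IsCompact K) (hKc : Convex ℝ K)
    (h0 : (0 : E3) ∈ K) (hKs : -K = K) {k : ℕ} (H : Fin k → Finset (E3 × ℝ))
    (ν : Fin k → Fin k → E3)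
    (hbd : ∀ j, Bornology.IsBounded (polytope (H j)))
    (hunit : ∀ j, ∀ q ∈ H j, ‖q.1‖ = 1)
    (hdist : ∀ j, ∀ q ∈ H j, ∀ q' ∈ H j, q ≠ q' →
      {x : E3 | ⟪q.1, x⟫ = q.2} ≠ {x : E3 | ⟪q'.1, x⟫ = q'.2})
    (hdisj : ∀ j j', j ≠ j' → Disjoint (polytope (H j)) (polytope (H j')))
    (hplane : ∀ j j', j ≠ j' → ‖ν j j'‖ = 1 ∧ ∃ b : ℝ,
      closure (polytope (H j)) ∩ closure (polytope (H j')) ⊆ {x | ⟪ν j j', x⟫ = b})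
    {A : Set E3} (hAm : MeasurableSet A) (hA : A =ᵐ[volume] ⋃ j, polytope (H j))
    (hAfin : perK K A ≠ ⊤) (s : Finset (Fin k))
    (hcl : closure (⋃ j ∈ s, polytope (H j)) ⊆ interior A) :
    2 * per K (⋃ j ∈ s, polytope (H j)) =
      ∑ a ∈ s, ∑ b ∈ (Finset.univ \ s),
        (if a < b then (supportFn K (ν a b) + supportFn K (-ν a b)) *
            facetArea (closure (polytope (H a)) ∩ closure (polytope (H b))) (ν a b)
          else (supportFn K (ν b a) + supportFn K (-ν b a)) *
            facetArea (closure (polytope (H b)) ∩ closure (polytope (H a))) (ν b a)) := by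
  have h := per_add_per_neg_eq_crossSum_compl hK hKc h0 H ν hbd hunit hdist hdisj hplane hAm hA
    hAfin s hcl
  rw [hKs] at h
  linarith

end Summit.Ventures.Crystal3D.Theorems

end
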